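import Summits.HodgeConjecture.HodgeConjecture.Theorems.HeckePrymWeilWeilTwelvefoldsSqrtMinus7IsotypicProductAnchor
import Summits.HodgeConjecture.HodgeConjecture.Theorems.HeckePrymWeilWeilTwelvefoldsSqrtMinus7IsotypicReach
import Literature.AlgebraicGeometry.HodgeTheory.InvariantClassesFromTotalSpaceHolds
import Literature.AlgebraicGeometry.HodgeTheory.WeilFamilyReachSystem
import HarnessLib

/-!
# Crux `WeilTwelvefoldsSqrtMinus7` (stmt-HodgeConjecture-1261), line `isotypic-unimodular-saturation` (r2) —
# REACH with a CM anchor, from the named fact `weilFamily_hyperbolic_weilSystem_reach`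

Skeleton r2 (`Cruxes/WeilTwelvefoldsSqrtMinus7/Lines/isotypic_unimodular_saturation.lean`, lead seat c3)
replaces the Hecke–Prym-product anchor `P′ × B′` of r1 (`stub_reach_of_facts`, which needed Schoen 1988 at
degree 7, `dim J = g` and the `F₂₁` Riemann-existence datum to certify the anchor's algebraic Weil plane)
by a CM anchor: ANY `ℚ(√-7)`-Weil twelvefold `(Z, φ_Z)` whose typed Weil plane is algebraic and which
carries a non-zero rational `(6,6)` Weil class (hypothesis `hZ`; the skeleton supplies `Z = B⁶`).  This
file proves the reach statement the r2 composition consumes, `reach_of_cmAnchor`, from EXACTLY the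
named fact `weilFamily_hyperbolic_weilSystem_reach` (Deligne's polarized Weil family over the hyperbolic
component, van Geemen §5; the tree has no universal abelian scheme) and `hZ`; Deligne's theorem of the
fixed part enters through the tree's DISCHARGED `deligne1968_invariantClass_fromTotalSpace_holds`.

Proof = lead c2's `stub_reach_of_facts` verbatim up to the anchor bullet: aiming
(`exists_cmSquare_descentPair_algebraic_aiming`) puts `A × B` on the hyperbolic component; the named
fact gives the family through `A × B`, the flat Weil section of a class `u` of the strong plane
(`stub_upgrade`) globalises (`stub_globalClassOfSection_of_leray`) and is rational everywhere
(`stub_rationalAlongSection`); NEW anchor bullet: aiming puts `Z × B` on the same component, the reach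
clause gives a fibre `(Y_{s₀}, Ψ_{s₀})` with an isogeny pair towards `Z × B`, whose typed Weil plane is
algebraic by the landed `stub_productAnchor`, and the global class restricts into it, hence is
ALGEBRAIC AT `s₀` — the generic anchor clause of `WeilVariationalHodge`.  No `sorry`, no new definition.
-/

noncomputable section

-- single-problem summit (Problem = Summit): the mandated namespace repeats `HodgeConjecture`.
set_option linter.dupNamespace false

open CategoryTheory
open Literature.AlgebraicGeometry Literature.AlgebraicGeometry.Motives
  Literature.AlgebraicGeometry.HodgeTheory Literature.AlgebraicTopology.SingularHomology
open Summit.HodgeConjecture.HodgeConjecture.Theorems.HeckePrymWeilLine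
  (stub_upgrade stub_rationalAlongSection stub_globalClassOfSection_of_leray)

namespace Summit.HodgeConjecture.HodgeConjecture.Theorems.WeilTwelvefoldsSqrtMinus7.IsotypicUnimodularSaturation

/-- **Reach with the CM anchor** (r2 replacement of r1's `stub_reach_of_facts`; the Hecke–Prym datum
is gone).  GIVEN the hyperbolic Weil family (F3, `hR`) and a `ℚ(√-7)`-Weil twelvefold `(Z, φ_Z)` with
algebraic typed Weil plane and a non-zero rational `(6,6)` Weil class (`hZ`, the CM anchor): for every
`ℚ(√-7)`-Weil twelvefold `(A, φ)` witnessed by a non-zero rational `(6,6)` Weil class there are the CM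
square `(B, φ_B)` with its descent pair, and a smooth projective family of 14-folds over a smooth
irreducible base through `A × B ≅ 𝒳_{s₁}`, along which every rational `(7,7)` class `u` of the typed Weil
plane of `(A × B, φ × φ_B)` globalises to a class `𝒰` that is rational `(7,7)` and fibrewise-Weil on every
fibre and ALGEBRAIC on one fibre `𝒳_{s₀}`.  Proof: c2's `stub_reach_of_facts` verbatim up to the anchor
— aiming (`exists_cmSquare_descentPair_algebraic_aiming`) puts `A × B` on the hyperbolic component, F3
gives the family, the flat Weil section of `u` (strong plane by `stub_upgrade`) globalises by Deligne
1968 (`stub_globalClassOfSection_of_leray` + `deligne1968_invariantClass_fromTotalSpace_holds`) and is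
rational everywhere (`stub_rationalAlongSection`); anchor: aiming puts `Z × B` on the same component,
F3's reach clause gives a fibre `(Y_{s₀}, Ψ_{s₀})` with an isogeny pair towards `Z × B`, whose typed Weil
plane is algebraic by the landed `stub_productAnchor`, and `𝒰|_{s₀}` lies in it.
[cite: Deligne1982HodgeCycles, proof of Thm. 4.8 (pp. 47–52) with Prop. 4.4]
[cite: vanGeemen1994HodgeAV, §5] [cite: Markman2025SurveySecant, §11.5 Step 2] -/
theorem reach_of_cmAnchor (hR : weilFamily_hyperbolic_weilSystem_reach)
    (hZ : ∃ (Z : AbelianVariety ℂ) (φZ : Z ⟶ Z), Z.dim = 12 ∧ φZ ≫ φZ = -((7 : ℤ) • 𝟙 Z) ∧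
      (∀ c : complexBetti Z.X 12,
        c ∈ Module.End.eigenspace (complexBetti.map (𝟙 Z + φZ).hom.hom.hom 12).hom
              ((1 + Complex.I * (Real.sqrt (7 : ℝ) : ℂ)) ^ 12) ⊔
            Module.End.eigenspace (complexBetti.map (𝟙 Z + φZ).hom.hom.hom 12).hom
              ((1 - Complex.I * (Real.sqrt (7 : ℝ) : ℂ)) ^ 12) →
        c ∈ algebraicClasses Z.X 6) ∧
      ∃ c : complexBetti Z.X 12, c ≠ 0 ∧ IsRationalClass c ∧ IsOfHodgeType 12 Z.X 12 6 6 c ∧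
        c ∈ Module.End.eigenspace (complexBetti.map (𝟙 Z + φZ).hom.hom.hom 12).hom
              ((1 + Complex.I * (Real.sqrt (7 : ℝ) : ℂ)) ^ 12) ⊔
            Module.End.eigenspace (complexBetti.map (𝟙 Z + φZ).hom.hom.hom 12).hom
              ((1 - Complex.I * (Real.sqrt (7 : ℝ) : ℂ)) ^ 12)) :
    ∀ (A : AbelianVariety ℂ) (φ : A ⟶ A), A.dim = 12 → φ ≫ φ = -((7 : ℤ) • 𝟙 A) →
    (∃ c : complexBetti A.X 12, c ≠ 0 ∧ IsRationalClass c ∧ IsOfHodgeType 12 A.X 12 6 6 c ∧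
      c ∈ Module.End.eigenspace (complexBetti.map (𝟙 A + φ).hom.hom.hom 12).hom
            ((1 + Complex.I * (Real.sqrt (7 : ℝ) : ℂ)) ^ 12) ⊔
          Module.End.eigenspace (complexBetti.map (𝟙 A + φ).hom.hom.hom 12).hom
            ((1 - Complex.I * (Real.sqrt (7 : ℝ) : ℂ)) ^ 12)) →
    ∃ (B : AbelianVariety ℂ) (φB : B ⟶ B), B.dim = 2 ∧ φB ≫ φB = -((7 : ℤ) • 𝟙 B) ∧
      (∃ bp bm η : complexBetti B.X 2,
        bp ∈ Module.End.eigenspace (complexBetti.map (𝟙 B + φB).hom.hom.hom 2).hom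
              ((1 + Complex.I * (Real.sqrt (7 : ℝ) : ℂ)) ^ 2) ∧
        bm ∈ Module.End.eigenspace (complexBetti.map (𝟙 B + φB).hom.hom.hom 2).hom
              ((1 - Complex.I * (Real.sqrt (7 : ℝ) : ℂ)) ^ 2) ∧
        IsRationalClass (bp + bm) ∧ IsOfHodgeType 2 B.X 2 1 1 (bp + bm) ∧
        η ∈ algebraicClasses B.X 1 ∧
        cupProduct (show 2 + 2 = 4 from rfl) bp η ≠ 0 ∧
        cupProduct (show 2 + 2 = 4 from rfl) bm η ≠ 0) ∧
      ∃ (𝒳 S : SchemeOver ℂ) (f : 𝒳 ⟶ S),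
        IsSmoothProjectiveFamily f 14 ∧ IrreducibleSpace S.left ∧ AlgebraicGeometry.Smooth S.hom ∧
        ∃ (s₁ : ComplexPoints S) (e₁ : (A.prod B).X ≅ fiberOver f s₁),
          ∀ u : complexBetti (A.prod B).X 14, IsRationalClass u →
            IsOfHodgeType 14 (A.prod B).X 14 7 7 u →
            u ∈ Module.End.eigenspace (complexBetti.map (𝟙 (A.prod B) +
                    AbelianVariety.prodLift (AbelianVariety.fst A B ≫ φ) (AbelianVariety.snd A B ≫ φB)).hom.hom.hom
                    14).hom ((1 + Complex.I * (Real.sqrt (7 : ℝ) : ℂ)) ^ 14) ⊔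
                Module.End.eigenspace (complexBetti.map (𝟙 (A.prod B) +
                    AbelianVariety.prodLift (AbelianVariety.fst A B ≫ φ) (AbelianVariety.snd A B ≫ φB)).hom.hom.hom
                    14).hom ((1 - Complex.I * (Real.sqrt (7 : ℝ) : ℂ)) ^ 14) →
            ∃ 𝒰 : complexBetti 𝒳 14,
              complexBetti.map e₁.hom 14 (complexBetti.map (fiberι f s₁) 14 𝒰) = u ∧
              (∀ s : ComplexPoints S,
                IsRationalClass (complexBetti.map (fiberι f s) 14 𝒰) ∧
                IsOfHodgeType 14 (fiberOver f s) 14 7 7 (complexBetti.map (fiberι f s) 14 𝒰)) ∧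
              (∀ s : ComplexPoints S, ∃ (Ys : AbelianVariety ℂ) (ψs : Ys ⟶ Ys) (es : Ys.X ≅ fiberOver f s),
                Ys.dim = 14 ∧ ψs ≫ ψs = -((7 : ℤ) • 𝟙 Ys) ∧
                complexBetti.map es.hom 14 (complexBetti.map (fiberι f s) 14 𝒰) ∈
                  Module.End.eigenspace (complexBetti.map (𝟙 Ys + ψs).hom.hom.hom 14).hom
                      ((1 + Complex.I * (Real.sqrt (7 : ℝ) : ℂ)) ^ 14) ⊔
                    Module.End.eigenspace (complexBetti.map (𝟙 Ys + ψs).hom.hom.hom 14).hom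
                      ((1 - Complex.I * (Real.sqrt (7 : ℝ) : ℂ)) ^ 14)) ∧
              ∃ s₀ : ComplexPoints S,
                complexBetti.map (fiberι f s₀) 14 𝒰 ∈ algebraicClasses (fiberOver f s₀) 7 := by
  intro A φ hA hφ hwit
  -- the CM square with its descent pair, algebraic Weil plane and aiming property
  obtain ⟨B, φB, hB, hφB, hpair, hBalg, haim⟩ := exists_cmSquare_descentPair_algebraic_aiming
  refine ⟨B, φB, hB, hφB, hpair, ?_⟩
  -- `A × B` is hyperbolic for a `K`-symmetrised hyperplane class (aiming at `n = 6`)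
  have hA' : A.dim = 2 * 6 := hA
  obtain ⟨e, a, ha, ha0, hhyp⟩ := haim 6 A φ (by norm_num) hA' hφ hwit
  set Φ := AbelianVariety.prodLift (AbelianVariety.fst A B ≫ φ) (AbelianVariety.snd A B ≫ φB) with hΦdef
  have hX : (A.prod B).dim = 2 * 7 := by rw [AbelianVariety.dim_prod, hA, hB]
  have hΦ : Φ ≫ Φ = -(((7 : ℕ) : ℤ) • 𝟙 (A.prod B)) :=
    prodLift_comp_self_eq_neg_zsmul (by exact_mod_cast hφ) (by exact_mod_cast hφB)
  have hhyp' : IsHyperbolicWeilType (A.prod B) Φ 7 (((7 : ℕ) : ℂ) • complexBetti.map e.ι 2 a +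
      complexBetti.map Φ.hom.hom.hom 2 (complexBetti.map e.ι 2 a)) := by
    simpa only [Nat.cast_ofNat] using hhyp
  -- (F3): the hyperbolic Weil family through `A × B`
  obtain ⟨𝒳, S, f, s₁, e₁, Y, Ψ, ε, hfam, hemb, hirr, hsm, hqp, hYs, hsec, hreach⟩ :=
    hR 7 7 (by norm_num) (by norm_num) (A.prod B) Φ e a hX hΦ ha ha0 hhyp'
  refine ⟨𝒳, S, f, hfam, hirr, hsm, s₁, e₁, ?_⟩
  intro u hur _huH huW
  -- `u` lies in the strong Weil plane of `(A × B, Φ)`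
  have huW' : u ∈ weilClassesOf (A.prod B) Φ 7 7 := by
    refine stub_upgrade 7 (by norm_num) (by norm_num) le_rfl 7 (A.prod B) Φ hX hΦ ?_
    exact_mod_cast huW
  -- its flat Weil section, and the global class of the section (W-engine, Deligne 1968)
  obtain ⟨σ, hσc, hσ₁, hσ⟩ := hsec u huW'
  have hpt : ∀ s, (σ s).pt = s := fun s => by
    obtain ⟨x, hx, -⟩ := hσ s
    rw [hx]
  obtain ⟨𝒰, h𝒰⟩ :=
    stub_globalClassOfSection_of_leray deligne1968_invariantClass_fromTotalSpace_holds f (2 * 7) (2 * 7)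
      hfam hemb hsm hqp hirr σ hσc hpt
  have hcls : ∀ (s : ComplexPoints S) (x : complexBetti (fiberOver f s) (2 * 7)),
      σ s = ⟨s, x⟩ → complexBetti.map (fiberι f s) 14 𝒰 = x := by
    intro s x hx
    have h := (h𝒰 s).symm.trans hx
    simp only [globalSection, FiberClass.mk.injEq, heq_eq_eq, true_and] at h
    exact h
  -- rationality along the section
  have hrat₁ : IsRationalClass (σ s₁).cls := by
    rw [hσ₁]
    exact hur.map _
  have hratσ : ∀ s, IsRationalClass (σ s).cls :=
    stub_rationalAlongSection f (2 * 7) (2 * 7) hfam hsm hqp hirr σ hσc hpt s₁ hrat₁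
  refine ⟨𝒰, ?_, ?_, ?_, ?_⟩
  · -- restriction to the fibre `𝒳_{s₁} ≅ A × B`
    rw [hcls s₁ _ hσ₁, ← CategoryTheory.comp_apply, ← complexBetti.map_comp, Iso.hom_inv_id,
      complexBetti.map_id]
    rfl
  · -- rational and of Hodge type `(7,7)` on every fibre
    intro s
    obtain ⟨x, hx, hxH, -⟩ := hσ s
    have h₁ := hratσ s
    rw [hx] at h₁
    rw [hcls s x hx]
    exact ⟨h₁, hxH⟩
  · -- a Weil class of the fibre's `ℚ(√-7)`-structure on every fibre
    intro s
    obtain ⟨x, hx, -, hxW⟩ := hσ s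
    obtain ⟨hYdim, hΨ⟩ := hYs s
    refine ⟨Y s, Ψ s, ε s, hYdim, by exact_mod_cast hΨ, ?_⟩
    rw [hcls s x hx]
    exact_mod_cast mem_eigenspace_sup_of_mem_weilClassesOf hxW
  · -- the CM anchor fibre: `Z × B` is hyperbolic (aiming), reached up to `K`-isogeny by a fibre,
    -- whose typed Weil plane is algebraic (`stub_productAnchor`), and `𝒰` restricts into it
    obtain ⟨Z, φZ, hZ12, hφZ, hZalg, hZwit⟩ := hZ
    have hZ12' : Z.dim = 2 * 6 := hZ12
    obtain ⟨e', a', ha', ha0', hhypP⟩ := haim 6 Z φZ (by norm_num) hZ12' hφZ hZwit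
    set ΨP := AbelianVariety.prodLift (AbelianVariety.fst Z B ≫ φZ) (AbelianVariety.snd Z B ≫ φB)
      with hΨPdef
    have hXP : (Z.prod B).dim = 2 * 7 := by rw [AbelianVariety.dim_prod, hZ12, hB]
    have hΨP : ΨP ≫ ΨP = -(((7 : ℕ) : ℤ) • 𝟙 (Z.prod B)) :=
      prodLift_comp_self_eq_neg_zsmul (by exact_mod_cast hφZ) (by exact_mod_cast hφB)
    have hhypP' : IsHyperbolicWeilType _ ΨP 7 (((7 : ℕ) : ℂ) • complexBetti.map e'.ι 2 a' +
        complexBetti.map ΨP.hom.hom.hom 2 (complexBetti.map e'.ι 2 a')) := by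
      simpa only [Nat.cast_ofNat] using hhypP
    obtain ⟨s₀, fY, gY, m, hflat, hm, hfg, hgψ⟩ := hreach _ ΨP e' a' hXP hΨP ha' ha0' hhypP'
    obtain ⟨x₀, hx₀, -, hx₀W⟩ := hσ s₀
    obtain ⟨hYdim, hΨ⟩ := hYs s₀
    have hΨ' : Ψ s₀ ≫ Ψ s₀ = -((7 : ℤ) • 𝟙 (Y s₀)) := by exact_mod_cast hΨ
    -- the typed Weil plane of the fibre `(Y_{s₀}, Ψ_{s₀})` is algebraic
    have hYalg := stub_productAnchor Z φZ hZ12 hφZ hZalg B φB hB hφB hBalg (Y s₀) (Ψ s₀) hYdim hΨ'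
      fY gY m hflat hm hfg hgψ
    -- `𝒰|_{s₀}`, read on `Y_{s₀}`, is a typed Weil class, hence algebraic there …
    have hxY : complexBetti.map (ε s₀).hom 14 x₀ ∈ algebraicClasses (Y s₀).X 7 :=
      hYalg _ (by exact_mod_cast mem_eigenspace_sup_of_mem_weilClassesOf hx₀W)
    -- … and so on the fibre, pulling back along `(ε s₀)⁻¹`
    refine ⟨s₀, ?_⟩
    have key := mem_algebraicClasses_map_of_iso (p := 7)
      (AbelianVariety.isSmoothProjective_holds (A := Y s₀)) (hfam.isSmoothProjective s₀) (ε s₀).symm hxY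
    have hid : complexBetti.map (ε s₀).symm.hom 14 (complexBetti.map (ε s₀).hom 14 x₀) = x₀ := by
      rw [← CategoryTheory.comp_apply, ← complexBetti.map_comp, Iso.symm_hom, Iso.inv_hom_id,
        complexBetti.map_id]
      rfl
    rw [hid] at key
    rw [hcls s₀ x₀ hx₀]
    exact key

end Summit.HodgeConjecture.HodgeConjecture.Theorems.WeilTwelvefoldsSqrtMinus7.IsotypicUnimodularSaturation

end
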